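import Summits.Ventures.CertifiedManyBodySolver.Theses.TcThermcert1
import Literature.MathematicalPhysics.QuantumLattice.DuhamelTwoPoint
import HarnessLib

/-!
# Sketch — crux idea «kms-lightcone-antipodal-covariance» (hub-tc-therm-idea-3, round 2)

Crux K1 = `Summit.Ventures.CertifiedManyBodySolver.Theses.TcThermcert1.ThermalStiffnessCeilingU8b10_le_1o8`
(`ObsThermalStiffnessSeqCeilingAtBeta 0 8 (7/8) 10 (1/8)`).

Lever: the KMS–Matsubara light-cone remainder bound (the even-operator twin of Hastings'
PRL 93 (2004) 126402 argument): for commuting, spatially separated `A`, `B` the equal-time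
expectation `⟨AB⟩_β` and the Duhamel (Kubo–Mori) function `(A;B)_β` differ by commutators
`[A(t), B]` only, weighted by the bosonic Matsubara kernel `e^{-2πt/β}/(1-e^{-2πt/β})`; with a
Lieb–Robinson bound this difference is exponentially small in the separation at ANY temperature
and in ANY phase.  Combined with the gauge-covariance (Ward) identity
`∂_θ² log Z_L(θ)|₀ = β² (I_0 ; I_X)_β` for every cut `X ≠ 0` (two-seam flux `f(a,b) = ℓ(a+b)`),
the finite-torus helicity modulus `Υ_L = -ℓ''(0)/β` equals `-β ⟨I_0 I_{⌊L/2⌋}⟩_{β,L}` up to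
`O(β L⁴ e^{-L/4} + β L² e^{-πL/(2vβ)})`.  Transfer target C⁺ = an eventual FLOOR `-1/40` on the
equal-time antipodal cut-current covariance of the flux-FREE canonical Gibbs state.

No statement here is proved; signatures only (sorries mark the statements of the line).
HONEST FRAMING: no summit statement proved; KT ceilings only; NO lower bound on T_c claimed.
-/

noncomputable section

namespace Summit.Ventures.CertifiedManyBodySolver.Cruxes.ThermalStiffnessCeilingU8b10_le_1o8.KMSLightCone

open Filter Topology Set Real MeasureTheory Matrix
open Literature.MathematicalPhysics.QuantumLattice
open Literature.Probability.LatticeModels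
open Summit.Ventures.CertifiedManyBodySolver.Observables
open Summit.Ventures.CertifiedManyBodySolver.Theses.TcThermcert1
open scoped Matrix.Norms.L2Operator ComplexOrder ComplexConjugate Classical

/-! ## §0 Objects -/

/-- Heisenberg evolution `A(t) = e^{itH} A e^{-itH}` of a matrix observable. -/
def heis {m : Type*} [Fintype m] [DecidableEq m] (H : Matrix m m ℂ) (t : ℝ) (A : Matrix m m ℂ) :
    Matrix m m ℂ :=
  NormedSpace.exp (((t : ℂ) * Complex.I) • H) * A * NormedSpace.exp ((-((t : ℂ) * Complex.I)) • H)

variable (L : ℕ) [NeZero L]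

/-- The **cut current** through the column cut `{x₁ = X-1} → {x₁ = X}` of the fermionic torus
(`t = 1`): `I_X = Σ_{y,σ} (-i c†_{(X,y)σ} c_{(X-1,y)σ} + i c†_{(X-1,y)σ} c_{(X,y)σ})`, i.e.
`∂_θ` at `θ = 0` of the seam twist `seamTwist L θ` translated to the cut `X` (the tree's seam is
`X = 0`).  Bru–de Siqueira Pedra's paramagnetic current `I_{(x,y)} = i(a*_y a_x - a*_x a_y)` summed
over the `L` bonds of the cut and the two spins. -/
def cutCurrent (X : ZMod L) :
    Matrix (Finset (Orb (FermionTorus 2 L))) (Finset (Orb (FermionTorus 2 L))) ℂ :=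
  ∑ y : ZMod L, ∑ σ : Fin 2,
    ((-Complex.I) • (creation (orb (FermionTorus.ofTorusSite ![X, y]) σ) *
        annihilation (orb (FermionTorus.ofTorusSite ![X - 1, y]) σ)) +
      Complex.I • (creation (orb (FermionTorus.ofTorusSite ![X - 1, y]) σ) *
        annihilation (orb (FermionTorus.ofTorusSite ![X, y]) σ)))

/-- The canonical `(N_L, S^z = 0)` coordinate sector of `thermalFluxLogZ` (`N_L = 2⌊(1-δ)L²/2⌋`). -/
def sectorPred (δ : ℝ) : Finset (Orb (FermionTorus 2 L)) → Prop :=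
  fun s => s.card = 2 * ⌊(1 - δ) * (L : ℝ) ^ 2 / 2⌋₊ ∧
    2 * (s.filter fun i => (ofLex i).2 = 0).card = 2 * ⌊(1 - δ) * (L : ℝ) ^ 2 / 2⌋₊

/-- The flux-free sector Hamiltonian `H_p = (H^{tt'}_L(θ = 0))|_p`. -/
def sectorHam (tp U δ : ℝ) : Matrix {s // sectorPred L δ s} {s // sectorPred L δ s} ℂ :=
  (hubbardTorusTT'Flux L tp U 0).toBlock (sectorPred L δ) (sectorPred L δ)

/-- The cut current compressed to the sector (it conserves `N↑`, `N↓`). -/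
def sectorCut (δ : ℝ) (X : ZMod L) : Matrix {s // sectorPred L δ s} {s // sectorPred L δ s} ℂ :=
  (cutCurrent L X).toBlock (sectorPred L δ) (sectorPred L δ)

/-- **Equal-time antipodal cut-current covariance** `⟨I_0 I_{⌊L/2⌋}⟩_{β,L}` in the flux-FREE canonical
Gibbs state (real part; `⟨I_X⟩ = 0` by time reversal, so this is the connected function). -/
def antipodalCurrentCov (tp U δ β : ℝ) : ℝ :=
  (gibbsState β (sectorHam L tp U δ)
    (sectorCut L δ 0 * sectorCut L δ ((L / 2 : ℕ) : ZMod L))).re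

/-- The finite-torus **helicity modulus** `Υ_L(β) = -ℓ''(0)/β`, `ℓ(θ) = thermalFluxLogZ L tp U δ β θ`. -/
def helicityModulus (tp U δ β : ℝ) : ℝ :=
  -(iteratedDeriv 2 (fun θ : ℝ => thermalFluxLogZ L tp U δ β θ) 0) / β

/-! ## §1 FIRST LEMMA — the KMS–Matsubara light-cone remainder bound (matrix level, model-free)

For Hermitian `H`, commuting `A`, `B` (`AB = BA`) and a linear light-cone bound
`‖[A(t), B]‖ ≤ κ |t|` on `|t| ≤ T`:
`|⟨AB⟩_β - (A;B)_β| ≤ κT/π + (2/π) ‖A‖ ‖B‖ e^{-2πT/β} / (1 - e^{-2πT/β})`.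
Proof sketch: Lehmann representation; `x coth x - 1 = 2x² Σ_{n≥1} (x² + π²n²)⁻¹` (`x = βω/2`) turns
`½⟨{A,B}⟩ - (A;B)` into `(i/β) ∫₀^∞ K(t) ⟨[A(t) - A(-t), B]⟩ dt`, `K(t) = Σ_{n≥1} e^{-2πnt/β} ≤ β/(2πt)`;
split the integral at `T`. -/
def KMSLightConeRemainderBound : Prop :=
  ∀ (m : Type) [Fintype m] [DecidableEq m] (β T κ : ℝ), 0 < β → 0 < T → 0 ≤ κ →
    ∀ H A B : Matrix m m ℂ, H.IsHermitian → A * B = B * A →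
      (∀ t ∈ Set.Icc (-T) T, ‖heis H t A * B - B * heis H t A‖ ≤ κ * |t|) →
      ‖gibbsState β H (A * B) - duhamel β H A B‖ ≤
        κ * T / π + 2 / π * ‖A‖ * ‖B‖ * (Real.exp (-(2 * π * T / β)) / (1 - Real.exp (-(2 * π * T / β))))

theorem stub_kmsLightConeRemainderBound : KMSLightConeRemainderBound := by
  sorry

/-! ## §2 The two model-side inputs (statements of the line, not proved here) -/

/-- **Ward / gauge covariance (antipodal Duhamel form of the stiffness).** `L ≥ 3`, `t' = 0`, any cut
`X ≠ 0`: `ℓ''(0) = β² · Re (I_0|_p ; I_X|_p)_{β}` for `ℓ = thermalFluxLogZ L 0 U δ β`; hence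
`Υ_L = -β (I_0;I_X)_β` is independent of `X ≠ 0`.  (Two seams `a` at `X = 0`, `b` at `X`:
`log Z(a,b) = ℓ(a+b)` by the gauge rotation `exp(i b N_{[0,X)})`, which is diagonal in the occupation
basis and preserves the sector; `∂_a ∂_b` at `0`; `∂_a∂_b H = 0` for disjoint cuts.) -/
def WardAntipodalDuhamel : Prop :=
  ∀ (L : ℕ) [NeZero L], 3 ≤ L → ∀ (U δ β : ℝ), 0 < β → ∀ X : ZMod L, X ≠ 0 →
    iteratedDeriv 2 (fun θ : ℝ => thermalFluxLogZ L 0 U δ β θ) 0 =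
      β ^ 2 * (duhamel β (sectorHam L 0 U δ) (sectorCut L δ 0) (sectorCut L δ X)).re

/-- **Lieb–Robinson input (fermionic, even observables, velocity set by the hopping only).** A linear
light-cone bound for the two compressed cut currents at graph distance `⌊L/2⌋ - 1`, uniform in `U`:
`‖[I_0(t), I_X]‖ ≤ C L² e^{-(⌊L/2⌋ - 1 - v|t|)} |t|` — constants `C, v` independent of `L, U, β`.
Bru–de Siqueira Pedra, LR bounds for multi-commutators (2017) Thm 4.3; on-site `U` removed in the
interaction picture (Nachtergaele–Sims–Young 2019). -/
def CutCurrentLightCone : Prop :=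
  ∃ C v : ℝ, 0 < C ∧ 0 < v ∧ ∀ (L : ℕ) [NeZero L], 3 ≤ L → ∀ (U δ t : ℝ),
    ‖heis (sectorHam L 0 U δ) t (sectorCut L δ 0) * sectorCut L δ ((L / 2 : ℕ) : ZMod L) -
        sectorCut L δ ((L / 2 : ℕ) : ZMod L) * heis (sectorHam L 0 U δ) t (sectorCut L δ 0)‖ ≤
      C * (L : ℝ) ^ 2 * Real.exp (-(((L / 2 : ℕ) : ℝ) - 1 - v * |t|)) * |t|

/-- **THE BRIDGE (target theorem of the line, unconditional):** at fixed `(U, δ, β)` the finite-torus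
helicity modulus and `-β ×` the equal-time antipodal cut-current covariance differ by `o(1)` as
`L → ∞` (rate exponential in `L`, length `max(4, 2vβ/π)`). -/
def HelicityEqualsAntipodalCov (U δ β : ℝ) : Prop :=
  Tendsto (fun L : ℕ => helicityModulus (L + 1) 0 U δ β + β * antipodalCurrentCov (L + 1) 0 U δ β)
    atTop (𝓝 0)

theorem stub_bridge (U δ β : ℝ) (hβ : 0 < β) :
    KMSLightConeRemainderBound → WardAntipodalDuhamel → CutCurrentLightCone →
      HelicityEqualsAntipodalCov U δ β := by
  sorry

/-! ## §3 Transfer: the equal-time floor C⁺ and C⁺ → K1 -/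

/-- **C⁺ (transfer target): eventual equal-time antipodal covariance floor at `β = 10`, `U = 8`,
`n = 7/8`, `t' = 0`:** `⟨I_0 I_{⌊L/2⌋}⟩_{10,L} ≥ -1/40 - ε` for all large `L` (normal phase: `→ 0`;
a phase of stiffness `Υ` would give `→ -Υ/10`). -/
def AntipodalCovFloorB10 : Prop :=
  ∀ ε : ℝ, 0 < ε → ∀ᶠ L : ℕ in atTop, ∀ [NeZero L], -(1 / 40 : ℝ) - ε ≤ antipodalCurrentCov L 0 8 (1 / 8) 10

/-- The leaf premise pins `ρ_s ≤ Υ_L/2` at every side (Taylor at `θ = 0` of the even real-analytic `ℓ`);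
with the bridge, `limsup_L Υ_L ≤ -10 · liminf_L ⟨I_0 I_{⌊L/2⌋}⟩ ≤ 1/4`, so `ρ_s ≤ 1/8`. -/
theorem stub_transfer :
    HelicityEqualsAntipodalCov 8 (1 / 8) 10 → AntipodalCovFloorB10 →
      ThermalStiffnessCeilingU8b10_le_1o8 := by
  sorry

end Summit.Ventures.CertifiedManyBodySolver.Cruxes.ThermalStiffnessCeilingU8b10_le_1o8.KMSLightCone
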